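/-
Copyright: the b2b-balaban T⁴-continuum CRUX team, row NE7b OWNER lineage `t4-ne7b-p1` (gen 138). Project licence.
-/
import Mathlib.Analysis.SpecificLimits.Basic
import Mathlib.Tactic.Linarith
import Mathlib.Tactic.Positivity
import Mathlib.Tactic.Ring
import Mathlib.Tactic.FieldSimp

/-!
# THE FIXED-BALL TEST IN THE (d10) FORMAT: **YES, CONDITIONALLY** — the irrelevant remainder letter `ρ` of the «couplings + remainder»
# class flows by `ρ_{k+1} ≤ μ·ρ_k + C·g_k² + ν·ρ_k²` (contraction `μ < 1` from power counting (431)∕(433), a source quadratic in the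
# marginal coupling `g_k`, a quadratic self-term), and GIVEN a bounded marginal trajectory `0 ≤ g_k ≤ ḡ` (the β-function's output — NOT
# proved here) the ball `ρ ≤ r := 2Cḡ²∕(1−μ)` is INVARIANT as soon as `ν·r ≤ (1−μ)∕2`, i.e. for `ḡ` small; inside it the remainder is
# attracted at rate `(1+μ)∕2 < 1`; together with (434)∕(435) (relevant couplings bounded uniformly in the horizon by tuning) EVERY datum
# of the class stays in a ball along the flow — the positive counterpart of (430)'s NO, modulo the marginal flow and the per-step
# letters `μ, C, ν` ((β3′)) (SCOPING (d10); row NE7b, node U5c; Mathlib only; [folklore] real recursions)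

Cell `pub-balaban`, sub-cell `t4`, spine estimate NE7b (`T4WeightBudget.RelWeightBound`; the cell's OWN estimate — NOT PRINTED in
[Bałaban 1983–89], NOT PROVED).  Crux-route work under `Spine/NE7b/` by the row OWNER (`t4-ne7b-p1` gen 138, file (436)) under FREEZE
(0)'s crux-prover clause; NOTHING of Bałaban's is named as a Lean object, valued or asserted; no `T4Continuum/Support` leaf typed; no
`def`, no notation; zero `sorry`.  Imports: Mathlib only (fast lane); (430)–(435) met BY SHAPE.

WHY.  (430): in the nine-sup-letter format the quadratic core grows by `2‖A‖² + c ≥ L² > 1` — no ball.  (431)–(433): in the located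
format the remainder letter (order `≥ 5` at `d = 4`, kernel∕sup-norm letters) contracts by `μ = L^{4−k} ≤ L⁻¹` per step, the relevant
data are extracted and tuned ((432), (434), (435)), and the marginal quartic `g` flows logarithmically (β-function).  What a step then
does to the remainder is, schematically, `ρ⁺ ≤ μρ + (new irrelevant terms generated from the couplings, O(g²)) + (nonlinear O(ρ²))`.
THIS FILE types the elementary consequence: such a recursion has an invariant ball of radius `O(ḡ²)` and attracts into it, for every
horizon, with explicit constants — so the (d10) class passes the fixed-ball test GIVEN (i) the marginal trajectory's bound `ḡ` (β-flow
team) and (ii) the per-step letters `μ < 1`, `C`, `ν` (the fluctuation step re-run in kernel letters = (β3′), NOT typed).  The test that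
killed the old format is thereby passed by the new one at the bookkeeping level; the analysis that produces (i) and (ii) is the road.

WHAT IS PROVED ([folklore]; `ρ g : ℕ → ℝ`, `μ C ν gbar r : ℝ`, `gbar` = `ḡ` the marginal coupling's bound):
* §1 `radius_closes` (`μ < 1`, `C ≥ 0`, `r = 2Cḡ²∕(1−μ)`, `νr ≤ (1−μ)∕2 ⟹ μr + Cḡ² + νr² ≤ r`), `radius_nonneg`.
* §2 **`remainder_invariant_ball`** (the recursion `ρ_{k+1} ≤ μρ_k + Cg_k² + νρ_k²`, `0 ≤ ρ`, `0 ≤ g_k ≤ ḡ`, a closing radius `r`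
  (`μr + Cḡ² + νr² ≤ r`), `ρ_0 ≤ r ⟹ ρ_k ≤ r` for all `k`), `remainder_invariant_ball_explicit` (with `r = 2Cḡ²∕(1−μ)` under `νr ≤ (1−μ)∕2`).
* §3 **`remainder_attracted`** (inside the ball the recursion is affine-contracting: `ρ_{k+1} ≤ (μ + νr)ρ_k + Cḡ²`, hence
  `ρ_k ≤ (μ+νr)^k ρ_0 + Cḡ²∕(1 − μ − νr)` when `μ + νr < 1`).
* §4 `smallness_threshold` (`ḡ² ≤ (1−μ)²∕(4Cν)`, `C, ν > 0 ⟹ ν·(2Cḡ²∕(1−μ)) ≤ (1−μ)∕2`: the explicit radius closes for small marginal coupling).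
* §5 toy (kernel): `μ = 1∕2`, `C = 1`, `ν = 0`, `ḡ = 1`: `r = 4` closes (`½·4 + 1 + 0 ≤ 4`).

HONEST (what this is NOT).  Schematic letter flow: the hypotheses `hrec` (the form of the remainder recursion), `μ < 1`, `C`, `ν` and the
marginal bound `ḡ` are INPUTS — producing them is (β3′) (kernel letters of the fluctuation output, decay of the dressed covariance),
(β4) (extraction to the marginal order with large-field suppression) and the β-function (B12 Thm 2); none is typed here.  Scalar
skeleton ((A3), NC-NE7b-α UNRULED); nothing of Bałaban's asserted.  BY-NAME EFFECT ON THE WALL: NONE.  NE7b NOT PRINTED ∕ NOT PROVED;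
spine PROVED 0∕9; rung (B)+1 — the programme's measures remain FINITE-torus statements; NOT the mass gap, NOT Clay.  HONEST DEPENDENCY:
continuum YM on T⁴ ⇐ BetaPertH ∧ nine spine estimates (0∕9 proved); BetaPertH ⇐ (D1) ∧ (D4) ∧ CAP+tail; G-an2-4 gates asym, D1 and NE2∕3∕4.
-/

set_option autoImplicit false

namespace Summit.QuantumFields.BalabanUV.T4Continuum.NE7b.SupRemainderFlowInvariantBall

open Filter Topology

variable {ρ g : ℕ → ℝ} {μ C ν gbar r : ℝ}

/-! ## §1. The closing radius -/

/-- **THE EXPLICIT RADIUS CLOSES**: `r = 2Cgbar²∕(1−μ)` with `νr ≤ (1−μ)∕2` (`μ < 1`, `C ≥ 0`) satisfies `μr + Cgbar² + νr² ≤ r`. [folklore] -/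
theorem radius_closes (hμ1 : μ < 1) (hC : 0 ≤ C) (hr : r = 2 * C * gbar ^ 2 / (1 - μ)) (hνr : ν * r ≤ (1 - μ) / 2) :
    μ * r + C * gbar ^ 2 + ν * r ^ 2 ≤ r := by
  have h1μ : 0 < 1 - μ := by linarith
  have hr0 : 0 ≤ r := by rw [hr]; positivity
  -- `Cgbar² = (1−μ)r/2` and `νr² ≤ (1−μ)r/2`
  have hCg : C * gbar ^ 2 = (1 - μ) * r / 2 := by
    rw [hr]; field_simp
  have hνr2 : ν * r ^ 2 ≤ (1 - μ) / 2 * r := by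
    have := mul_le_mul_of_nonneg_right hνr hr0
    nlinarith
  nlinarith

/-- The explicit radius is nonnegative. [folklore] -/
theorem radius_nonneg (hμ1 : μ < 1) (hC : 0 ≤ C) (hr : r = 2 * C * gbar ^ 2 / (1 - μ)) : 0 ≤ r := by
  have h1μ : 0 < 1 - μ := by linarith
  rw [hr]; positivity

/-! ## §2. The invariant ball -/

/-- **THE REMAINDER'S INVARIANT BALL**: if `ρ_{k+1} ≤ μρ_k + Cg_k² + νρ_k²` with `ρ ≥ 0`, `0 ≤ g_k ≤ gbar`, `μ, C, ν ≥ 0`, and `r` closes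
(`μr + Cgbar² + νr² ≤ r`), then `ρ_0 ≤ r ⟹ ρ_k ≤ r` for every `k`. [folklore] -/
theorem remainder_invariant_ball (hμ0 : 0 ≤ μ) (hC : 0 ≤ C) (hν : 0 ≤ ν) (hρ0 : ∀ k, 0 ≤ ρ k) (hg : ∀ k, 0 ≤ g k ∧ g k ≤ gbar)
    (hrec : ∀ k, ρ (k + 1) ≤ μ * ρ k + C * g k ^ 2 + ν * ρ k ^ 2) (hclose : μ * r + C * gbar ^ 2 + ν * r ^ 2 ≤ r) (h0 : ρ 0 ≤ r) :
    ∀ k : ℕ, ρ k ≤ r := by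
  intro k
  induction k with
  | zero => exact h0
  | succ k ih =>
    have hgk := hg k
    have hg2 : g k ^ 2 ≤ gbar ^ 2 := pow_le_pow_left₀ hgk.1 hgk.2 2
    have hρ2 : ρ k ^ 2 ≤ r ^ 2 := pow_le_pow_left₀ (hρ0 k) ih 2
    calc ρ (k + 1) ≤ μ * ρ k + C * g k ^ 2 + ν * ρ k ^ 2 := hrec k
      _ ≤ μ * r + C * gbar ^ 2 + ν * r ^ 2 := by gcongr
      _ ≤ r := hclose

/-- **WITH THE EXPLICIT RADIUS**: under `νr ≤ (1−μ)∕2` for `r = 2Cgbar²∕(1−μ)` (`0 ≤ μ < 1`), `ρ_0 ≤ r ⟹ ρ_k ≤ r` for all `k`. [folklore] -/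
theorem remainder_invariant_ball_explicit (hμ0 : 0 ≤ μ) (hμ1 : μ < 1) (hC : 0 ≤ C) (hν : 0 ≤ ν) (hρ0 : ∀ k, 0 ≤ ρ k)
    (hg : ∀ k, 0 ≤ g k ∧ g k ≤ gbar) (hrec : ∀ k, ρ (k + 1) ≤ μ * ρ k + C * g k ^ 2 + ν * ρ k ^ 2) (hr : r = 2 * C * gbar ^ 2 / (1 - μ))
    (hνr : ν * r ≤ (1 - μ) / 2) (h0 : ρ 0 ≤ r) : ∀ k : ℕ, ρ k ≤ r :=
  remainder_invariant_ball hμ0 hC hν hρ0 hg hrec (radius_closes hμ1 hC hr hνr) h0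

/-! ## §3. Attraction inside the ball -/

/-- **INSIDE THE BALL THE REMAINDER IS ATTRACTED**: if `ρ_k ≤ r` for all `k` (§2) then `ρ_{k+1} ≤ (μ + νr)ρ_k + Cgbar²`, and with
`θ := μ + νr < 1`: `ρ_k ≤ θ^k ρ_0 + Cgbar²∕(1−θ)`. [folklore] -/
theorem remainder_attracted (hμ0 : 0 ≤ μ) (hC : 0 ≤ C) (hν : 0 ≤ ν) (hρ0 : ∀ k, 0 ≤ ρ k) (hg : ∀ k, 0 ≤ g k ∧ g k ≤ gbar)
    (hrec : ∀ k, ρ (k + 1) ≤ μ * ρ k + C * g k ^ 2 + ν * ρ k ^ 2) (hball : ∀ k, ρ k ≤ r) (hθ : μ + ν * r < 1) :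
    ∀ k : ℕ, ρ k ≤ (μ + ν * r) ^ k * ρ 0 + C * gbar ^ 2 / (1 - (μ + ν * r)) := by
  have hθ0 : 0 ≤ μ + ν * r := by
    have : 0 ≤ r := (hρ0 0).trans (hball 0)
    positivity
  have h1θ : 0 < 1 - (μ + ν * r) := by linarith
  have hCg : 0 ≤ C * gbar ^ 2 := by positivity
  -- the affine-contracting step
  have hstep : ∀ k, ρ (k + 1) ≤ (μ + ν * r) * ρ k + C * gbar ^ 2 := by
    intro k
    have hgk := hg k
    have hg2 : g k ^ 2 ≤ gbar ^ 2 := pow_le_pow_left₀ hgk.1 hgk.2 2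
    have hρ2 : ν * ρ k ^ 2 ≤ ν * r * ρ k := by
      have : ρ k ^ 2 ≤ r * ρ k := by rw [sq]; exact mul_le_mul_of_nonneg_right (hball k) (hρ0 k)
      nlinarith
    calc ρ (k + 1) ≤ μ * ρ k + C * g k ^ 2 + ν * ρ k ^ 2 := hrec k
      _ ≤ μ * ρ k + C * gbar ^ 2 + ν * r * ρ k := by gcongr
      _ = (μ + ν * r) * ρ k + C * gbar ^ 2 := by ring
  intro k
  induction k with
  | zero =>
    rw [pow_zero, one_mul]
    exact le_add_of_nonneg_right (div_nonneg hCg h1θ.le)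
  | succ k ih =>
    have h2 : (μ + ν * r) * ((μ + ν * r) ^ k * ρ 0 + C * gbar ^ 2 / (1 - (μ + ν * r))) + C * gbar ^ 2 =
        (μ + ν * r) ^ (k + 1) * ρ 0 + C * gbar ^ 2 / (1 - (μ + ν * r)) := by
      rw [pow_succ]
      field_simp
      ring
    calc ρ (k + 1) ≤ (μ + ν * r) * ρ k + C * gbar ^ 2 := hstep k
      _ ≤ (μ + ν * r) * ((μ + ν * r) ^ k * ρ 0 + C * gbar ^ 2 / (1 - (μ + ν * r))) + C * gbar ^ 2 := by gcongr
      _ = (μ + ν * r) ^ (k + 1) * ρ 0 + C * gbar ^ 2 / (1 - (μ + ν * r)) := h2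

/-! ## §4. The smallness threshold on the marginal coupling -/

/-- **THE EXPLICIT RADIUS CLOSES FOR SMALL MARGINAL COUPLING**: `C, ν > 0`, `μ < 1`, `gbar² ≤ (1−μ)²∕(4Cν) ⟹ ν·(2Cgbar²∕(1−μ)) ≤ (1−μ)∕2`. [folklore] -/
theorem smallness_threshold (hμ1 : μ < 1) (hC : 0 < C) (hν : 0 < ν) (hgbar : gbar ^ 2 ≤ (1 - μ) ^ 2 / (4 * C * ν)) :
    ν * (2 * C * gbar ^ 2 / (1 - μ)) ≤ (1 - μ) / 2 := by
  have h1μ : 0 < 1 - μ := by linarith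
  have h1 : ν * (2 * C * gbar ^ 2 / (1 - μ)) = (2 * C * ν / (1 - μ)) * gbar ^ 2 := by
    field_simp
  rw [h1]
  calc 2 * C * ν / (1 - μ) * gbar ^ 2 ≤ 2 * C * ν / (1 - μ) * ((1 - μ) ^ 2 / (4 * C * ν)) :=
        mul_le_mul_of_nonneg_left hgbar (by positivity)
    _ = (1 - μ) / 2 := by
        field_simp
        ring

/-! ## §5. Toy -/

/-- Toy (kernel): `μ = 1∕2`, `C = 1`, `ν = 0`, `gbar = 1`: the radius `r = 4` closes. -/
example : (1 / 2 : ℝ) * 4 + 1 * 1 ^ 2 + 0 * 4 ^ 2 ≤ 4 := by norm_num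

end Summit.QuantumFields.BalabanUV.T4Continuum.NE7b.SupRemainderFlowInvariantBall
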